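/-
Copyright (c) 2026. All rights reserved.
Released under Apache 2.0 license as described in the file LICENSE.
Authors: abc-iut cell, block-F prover seat abc-iut-f-167 (gen 4).
-/
import Literature.IUT.LogVolume.LocalFieldTraceRetraction
import Literature.IUT.LogVolume.LocalUnitLogEquivariance
import Literature.IUT.LogVolume.LogUnitsSubmodule
import Mathlib.NumberTheory.Padics.Complex
import Mathlib.RingTheory.Norm.Transitivity
import Mathlib.RingTheory.Trace.Basic
import HarnessLib

/-!
# `log_p ∘ N_{k'/k} = Tr_{k'/k} ∘ log_p` on units of `p`-adic fields; item (X) at every degree prime to `p`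

abc-iut cell, prover seat abc-iut-f-167 (gen 4); sequel to `LocalFieldTraceRetraction` (abc-iut-w5-d036: the
normalised trace `[k':k]⁻¹·Tr_{k'/k}` is a retraction of an embedding `σ : k → k'` of `p`-adic fields which maps
`log_p(R'^×)` into `log_p(R^×)` when both fields are TAME and `p ∤ [k':k]`) and to `TensorPacketSaturation`
(abc-iut-f-167 gen 3: tame tuples of any degree).  HERE the tameness hypothesis of the coprime-degree route is
REMOVED, by the classical compatibility of the `p`-adic logarithm with norm and trace:

* `unitLog_mul_of_isPrincipal_pow`, `unitLog_prod_of_isPrincipal_pow` — `log_p` of a (finite) product of units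
  admitting a COMMON principal-unit exponent is the sum of the `log_p`'s, in any complete ultrametric normed
  `ℚ_p`-algebra field (no local compactness: used inside `ℂ_p`);
* **`unitLog_norm_eq_trace_unitLog`** — for `p`-adic fields `k ⊆ k'` (any `k`-algebra structure on `k'`
  compatible with `ℚ_p`, e.g. an embedding `σ : k → k'`: `…_of_algHom`) and `u ∈ 𝒪_{k'}^×`:
  **`log_p (N_{k'/k} u) = Tr_{k'/k} (log_p u)`**.  Proof: embed `k ↪ ℂ_p` (`IsAlgClosed.lift`; Mathlib's `ℂ_p`
  is complete and algebraically closed); `N u = ∏_τ τ u` and `Tr z = Σ_τ τ z` over the `k`-embeddings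
  `τ : k' → ℂ_p` (`Algebra.norm_eq_prod_embeddings`, `trace_eq_sum_embeddings`); every `τ` and `k ↪ ℂ_p` is an
  isometry (`norm_map_algHom`, uniqueness of the extended absolute value) and hence commutes with `log_p`
  (`unitLog_map`); and `log_p ∏_τ τ u = Σ_τ log_p (τ u)` with the common exponent `a`, `u^a ∈ U^{(1)}`;
* `norm_algebraNorm_eq_one(_of_algHom)` — `‖N_{k'/k} u‖ = 1`; `trace_mem_logUnits(_of_algHom)` —
  **`Tr_{k'/k}(log_p(R'^×)) ⊆ log_p(R^×)`**;
* **`exists_logUnits_retraction_of_not_dvd`** — if `p ∤ [k':k]` (ANY ramification, any `p`) the normalised trace is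
  a `ℚ_p`-linear retraction `r` of `σ` with `r(log_p(R'^×)) ⊆ log_p(R^×)` (`[k':k]⁻¹ ∈ ℤ_p^×` and `log_p(R^×)` is a
  `ℤ_p`-module, `smul_mem_logUnits`);
* **`packetLogμ_packetHull_orbit_slotUnion_le_of_not_dvd`** (+ `'` with `φ = ⊗σ_i` supplied, + `_of_norm_eq`) —
  item (X) of the G1-Θ memo (abc-iut-w5-d166) for embeddings `σ_i : k_i → k'_i` with `p ∤ [k'_i : σ_i k_i]` and NO
  tameness / NO `p > 2` hypothesis:
  `log μ̄(hull(⋃_γ γ·⋃_i ι_i(g_i)·(R_I)^∼)) ≤ log μ̄'(hull'(⋃_{γ'} γ'·⋃_i ι'_i(σ_i g_i)·(R'_I)^∼))`.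

With `TensorPacketSaturation` (tame, any degree) this leaves item (X) open only at tuples having a WILD factor
(`e ≥ p − 1`, or `p = 2`) of degree DIVISIBLE by `p`.

Classical local algebra [cite: NeukirchANT1999, Ch. II (4.8), (5.5)]; (Ind2)/the hull/`log μ̄` are the tree's
typings of constructions of the disputed corpus [claim: Mochizuki2012, status: disputed]; nothing here asserts
abc or takes a side on [IUTchIII] Cor. 3.12; typed ≠ proved. PROOF-ONLY file: no definitions, no `Prop` facts.
[cite: Mochizuki2012, IUTchIV Prop. 1.2 (i)(ii) p. 10, Thm 1.10 proof Step (v) p. 27–28]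
[cite: DupuyHilado2025, §4.7, §4.9, §4.12]
-/

noncomputable section

open Set Module
open scoped Pointwise TensorProduct

namespace Literature.IUT.LogVolume

/-! ## §0 `log_p` of a product with a common principal-unit exponent (no local compactness) -/

section Prod

variable {E : Type*} [NontriviallyNormedField E] [IsUltrametricDist E]

/-- A finite product of principal units is a principal unit. [cite: NeukirchANT1999, Ch. II (5.5)] -/
theorem isPrincipal_finset_prod {ι : Type*} (s : Finset ι) (f : ι → E) (hf : ∀ i ∈ s, IsPrincipal (f i)) :
    IsPrincipal (∏ i ∈ s, f i) := by
  classical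
  induction s using Finset.induction_on with
  | empty => simp [isPrincipal_iff]
  | insert i s hi ih =>
    rw [Finset.prod_insert hi]
    exact (hf i (Finset.mem_insert_self i s)).mul (ih fun j hj => hf j (Finset.mem_insert_of_mem hj))

variable (p : ℕ) [Fact p.Prime] [instE : NormedAlgebra ℚ_[p] E] [CompleteSpace E]
include instE

/-- `log_p (x y) = log_p x + log_p y` for `x, y` with a COMMON exponent `a ≥ 1` such that `x^a`, `y^a` are
principal units — in any complete ultrametric normed `ℚ_p`-algebra field (the tree's `unitLog_mul` needs local
compactness to FIND such an exponent; here it is given). [cite: NeukirchANT1999, Ch. II (5.5)] -/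
theorem unitLog_mul_of_isPrincipal_pow {x y : E} {a : ℕ} (ha : 0 < a) (hx : IsPrincipal (x ^ a))
    (hy : IsPrincipal (y ^ a)) : unitLog (x * y) = unitLog x + unitLog y := by
  have hxy : IsPrincipal ((x * y) ^ a) := by rw [mul_pow]; exact hx.mul hy
  rw [unitLog_eq_inv_mul_logSeries p ha hxy, unitLog_eq_inv_mul_logSeries p ha hx,
    unitLog_eq_inv_mul_logSeries p ha hy, mul_pow, logSeries_mul p hx hy, mul_add]

/-- `log_p (∏_{i∈s} f i) = Σ_{i∈s} log_p (f i)` when all `(f i)^a` are principal units for one common `a ≥ 1`.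
[cite: NeukirchANT1999, Ch. II (5.5)] -/
theorem unitLog_prod_of_isPrincipal_pow {ι : Type*} (s : Finset ι) (f : ι → E) {a : ℕ} (ha : 0 < a)
    (hf : ∀ i ∈ s, IsPrincipal (f i ^ a)) : unitLog (∏ i ∈ s, f i) = ∑ i ∈ s, unitLog (f i) := by
  classical
  induction s using Finset.induction_on with
  | empty => simp [unitLog_one p]
  | insert i s hi ih =>
    rw [Finset.prod_insert hi, Finset.sum_insert hi]
    have hfi : IsPrincipal (f i ^ a) := hf i (Finset.mem_insert_self i s)
    have hs : ∀ j ∈ s, IsPrincipal (f j ^ a) := fun j hj => hf j (Finset.mem_insert_of_mem hj)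
    have hprod : IsPrincipal ((∏ j ∈ s, f j) ^ a) := by
      rw [← Finset.prod_pow]
      exact isPrincipal_finset_prod s (fun j => f j ^ a) hs
    rw [unitLog_mul_of_isPrincipal_pow p ha hfi hprod, ih hs]

end Prod

/-! ## §1 `log_p ∘ N = Tr ∘ log_p` -/

section NormTrace

variable {p : ℕ} [Fact p.Prime]
variable {k k' : Type} [NontriviallyNormedField k] [NormedAlgebra ℚ_[p] k] [IsUltrametricDist k] [ProperSpace k]
  [NontriviallyNormedField k'] [NormedAlgebra ℚ_[p] k'] [IsUltrametricDist k'] [ProperSpace k']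

variable (p) in
/-- **`log_p (N_{k'/k} u) = Tr_{k'/k} (log_p u)`** for a `p`-adic field `k'` which is a `k`-algebra compatibly
with the `ℚ_p`-structures (`IsScalarTower ℚ_p k k'`; e.g. the structure given by an embedding `σ : k → k'`) and a
unit `u`, `‖u‖ = 1`: in `ℂ_p`, `N u = ∏_τ τ u` and `Tr = Σ_τ τ` over the `k`-embeddings `τ : k' → ℂ_p`, each an
isometry commuting with `log_p`, and `log_p ∏_τ τ u = Σ_τ log_p (τ u)` (common principal-unit exponent).
[cite: NeukirchANT1999, Ch. II (4.8), (5.5)] -/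
theorem unitLog_norm_eq_trace_unitLog [Algebra k k'] [IsScalarTower ℚ_[p] k k'] {u : k'} (hu : ‖u‖ = 1) :
    unitLog (Algebra.norm k u) = Algebra.trace k k' (unitLog u) := by
  haveI : FiniteDimensional ℚ_[p] k := FiniteDimensional.of_locallyCompactSpace ℚ_[p]
  haveI : FiniteDimensional ℚ_[p] k' := FiniteDimensional.of_locallyCompactSpace ℚ_[p]
  haveI : FiniteDimensional k k' := Module.Finite.of_restrictScalars_finite ℚ_[p] k k'
  haveI : CharZero k := charZero_of_injective_algebraMap (algebraMap ℚ_[p] k).injective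
  haveI : Algebra.IsSeparable k k' := Algebra.IsSeparable.of_integral k k'
  haveI : Algebra.IsAlgebraic ℚ_[p] k := Algebra.IsAlgebraic.of_finite ℚ_[p] k
  -- embed `k` into `ℂ_p`
  let τ₀ : k →ₐ[ℚ_[p]] ℂ_[p] := IsAlgClosed.lift
  letI : Algebra k ℂ_[p] := τ₀.toRingHom.toAlgebra
  haveI : IsScalarTower ℚ_[p] k ℂ_[p] := IsScalarTower.of_algebraMap_eq fun x => (τ₀.commutes x).symm
  have hτ₀n : ∀ x, ‖τ₀.toRingHom x‖ = ‖x‖ := fun x => norm_map_algHom τ₀ x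
  have hτn : ∀ (τ : k' →ₐ[k] ℂ_[p]) (x : k'), ‖τ.toRingHom x‖ = ‖x‖ := fun τ x =>
    norm_map_algHom (τ.restrictScalars ℚ_[p]) x
  -- a common principal-unit exponent for all conjugates of `u`
  obtain ⟨a, ha, haP⟩ := exists_pow_isPrincipal hu
  have hτP : ∀ τ : k' →ₐ[k] ℂ_[p], IsPrincipal ((τ u) ^ a) := fun τ =>
    (isPrincipal_map_pow_iff τ.toRingHom (hτn τ) u a).mpr haP
  -- compute in `ℂ_p`
  have hinj : Function.Injective τ₀.toRingHom := τ₀.toRingHom.injective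
  apply hinj
  have hN : τ₀.toRingHom (Algebra.norm k u) = ∏ τ : k' →ₐ[k] ℂ_[p], τ u :=
    Algebra.norm_eq_prod_embeddings k ℂ_[p] u
  have hT : τ₀.toRingHom (Algebra.trace k k' (unitLog u)) = ∑ τ : k' →ₐ[k] ℂ_[p], τ (unitLog u) :=
    trace_eq_sum_embeddings ℂ_[p]
  rw [← unitLog_map p τ₀.toRingHom hτ₀n, hN, hT,
    unitLog_prod_of_isPrincipal_pow p Finset.univ (fun τ : k' →ₐ[k] ℂ_[p] => τ u) ha (fun τ _ => hτP τ)]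
  refine Finset.sum_congr rfl fun τ _ => ?_
  exact unitLog_map p τ.toRingHom (hτn τ) u

/-- `log_p (N_{k'/k} u) = Tr_{k'/k} (log_p u)` for the `k`-algebra structure on `k'` given by an EMBEDDING
`σ : k → k'` of `p`-adic fields (the shape consumed by `LocalFieldTraceRetraction`).
[cite: NeukirchANT1999, Ch. II (4.8), (5.5)] -/
theorem unitLog_norm_eq_trace_unitLog_of_algHom (σ : k →ₐ[ℚ_[p]] k') {u : k'} (hu : ‖u‖ = 1) :
    letI := σ.toRingHom.toAlgebra
    unitLog (Algebra.norm k u) = Algebra.trace k k' (unitLog u) := by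
  letI : Algebra k k' := σ.toRingHom.toAlgebra
  haveI : IsScalarTower ℚ_[p] k k' := IsScalarTower.of_algebraMap_eq fun x => (σ.commutes x).symm
  exact unitLog_norm_eq_trace_unitLog p hu

variable (p) in
/-- **`‖N_{k'/k} u‖ = 1`** for a unit `u` (`N u = ∏_τ τ u` in `ℂ_p`, all factors of norm `1`).
[cite: NeukirchANT1999, Ch. II (4.8)] -/
theorem norm_algebraNorm_eq_one [Algebra k k'] [IsScalarTower ℚ_[p] k k'] {u : k'} (hu : ‖u‖ = 1) :
    ‖Algebra.norm k u‖ = 1 := by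
  haveI : FiniteDimensional ℚ_[p] k := FiniteDimensional.of_locallyCompactSpace ℚ_[p]
  haveI : FiniteDimensional ℚ_[p] k' := FiniteDimensional.of_locallyCompactSpace ℚ_[p]
  haveI : FiniteDimensional k k' := Module.Finite.of_restrictScalars_finite ℚ_[p] k k'
  haveI : CharZero k := charZero_of_injective_algebraMap (algebraMap ℚ_[p] k).injective
  haveI : Algebra.IsSeparable k k' := Algebra.IsSeparable.of_integral k k'
  haveI : Algebra.IsAlgebraic ℚ_[p] k := Algebra.IsAlgebraic.of_finite ℚ_[p] k
  let τ₀ : k →ₐ[ℚ_[p]] ℂ_[p] := IsAlgClosed.lift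
  letI : Algebra k ℂ_[p] := τ₀.toRingHom.toAlgebra
  haveI : IsScalarTower ℚ_[p] k ℂ_[p] := IsScalarTower.of_algebraMap_eq fun x => (τ₀.commutes x).symm
  have hN : τ₀.toRingHom (Algebra.norm k u) = ∏ τ : k' →ₐ[k] ℂ_[p], τ u :=
    Algebra.norm_eq_prod_embeddings k ℂ_[p] u
  rw [← norm_map_algHom τ₀ (Algebra.norm k u)]
  change ‖τ₀.toRingHom (Algebra.norm k u)‖ = 1
  rw [hN, norm_prod]
  refine Finset.prod_eq_one fun τ _ => ?_
  rw [show ‖τ u‖ = ‖(τ.restrictScalars ℚ_[p]) u‖ from rfl, norm_map_algHom, hu]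

/-- `‖N_{k'/k} u‖ = 1` for a unit `u`, embedding form. [cite: NeukirchANT1999, Ch. II (4.8)] -/
theorem norm_algebraNorm_eq_one_of_algHom (σ : k →ₐ[ℚ_[p]] k') {u : k'} (hu : ‖u‖ = 1) :
    letI := σ.toRingHom.toAlgebra
    ‖Algebra.norm k u‖ = 1 := by
  letI : Algebra k k' := σ.toRingHom.toAlgebra
  haveI : IsScalarTower ℚ_[p] k k' := IsScalarTower.of_algebraMap_eq fun x => (σ.commutes x).symm
  exact norm_algebraNorm_eq_one p hu

variable (p) in
/-- **`Tr_{k'/k}(log_p(R'^×)) ⊆ log_p(R^×)`**: `Tr (log_p u) = log_p (N u)` and `N u` is a unit.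
[cite: NeukirchANT1999, Ch. II (4.8), (5.5)] -/
theorem trace_mem_logUnits [Algebra k k'] [IsScalarTower ℚ_[p] k k'] {z : k'} (hz : z ∈ logUnits k') :
    Algebra.trace k k' z ∈ logUnits k := by
  obtain ⟨u, hu, rfl⟩ := mem_logUnits_iff.mp hz
  rw [← unitLog_norm_eq_trace_unitLog p hu]
  exact unitLog_mem_logUnits (norm_algebraNorm_eq_one p hu)

/-- `Tr_{k'/k}(log_p(R'^×)) ⊆ log_p(R^×)`, embedding form. [cite: NeukirchANT1999, Ch. II (4.8), (5.5)] -/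
theorem trace_mem_logUnits_of_algHom (σ : k →ₐ[ℚ_[p]] k') {z : k'} (hz : z ∈ logUnits k') :
    letI := σ.toRingHom.toAlgebra
    Algebra.trace k k' z ∈ logUnits k := by
  letI : Algebra k k' := σ.toRingHom.toAlgebra
  haveI : IsScalarTower ℚ_[p] k k' := IsScalarTower.of_algebraMap_eq fun x => (σ.commutes x).symm
  exact trace_mem_logUnits p hz

variable (p) in
/-- **Degree prime to `p` ⇒ a `ℚ_p`-linear retraction of `σ` mapping `log_p(R'^×)` into `log_p(R^×)`, at ANY
ramification** (the normalised trace `r = [k':k]⁻¹·Tr_{k'/k}`: `Tr` maps log-units to log-units, and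
`[k':k]⁻¹ ∈ ℤ_p^×` acts on the `ℤ_p`-module `log_p(R^×)`). [cite: NeukirchANT1999, Ch. II (4.8), (5.5)]
[cite: Mochizuki2012, IUTchIV Prop. 1.2 (i)(ii) p. 10] -/
theorem exists_logUnits_retraction_of_not_dvd (σ : k →ₐ[ℚ_[p]] k')
    (hn : letI := σ.toRingHom.toAlgebra; ¬ p ∣ Module.finrank k k') :
    ∃ r : k' →ₗ[ℚ_[p]] k, (∀ a, r (σ a) = a) ∧ ∀ z, z ∈ logUnits k' → r z ∈ logUnits k := by
  letI : Algebra k k' := σ.toRingHom.toAlgebra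
  haveI : IsScalarTower ℚ_[p] k k' := IsScalarTower.of_algebraMap_eq fun x => (σ.commutes x).symm
  haveI : FiniteDimensional ℚ_[p] k' := FiniteDimensional.of_locallyCompactSpace ℚ_[p]
  haveI : FiniteDimensional k k' := Module.Finite.of_restrictScalars_finite ℚ_[p] k k'
  set n : ℕ := Module.finrank k k' with hndef
  have hn0 : n ≠ 0 := Module.finrank_pos.ne'
  have hnQ : (n : ℚ_[p]) ≠ 0 := Nat.cast_ne_zero.mpr hn0
  have hnorm : ‖(n : ℚ_[p])‖ = 1 :=
    Padic.norm_natCast_eq_one_iff.mpr ((Nat.Prime.coprime_iff_not_dvd (Fact.out : p.Prime)).mpr hn)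
  have hnorm' : ‖(n : ℚ_[p])⁻¹‖ ≤ 1 := by rw [norm_inv, hnorm, inv_one]
  refine ⟨(n : ℚ_[p])⁻¹ • (Algebra.trace k k').restrictScalars ℚ_[p], fun a => ?_, fun z hz => ?_⟩
  · have hσ : σ a = algebraMap k k' a := rfl
    rw [LinearMap.smul_apply, LinearMap.restrictScalars_apply, hσ, Algebra.trace_algebraMap,
      ← Nat.cast_smul_eq_nsmul ℚ_[p], smul_smul, inv_mul_cancel₀ hnQ, one_smul]
  · rw [LinearMap.smul_apply, LinearMap.restrictScalars_apply]
    have htr : Algebra.trace k k' z ∈ logUnits k := trace_mem_logUnits p hz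
    -- `[k':k]⁻¹ ∈ ℤ_p` acts on the `ℤ_p`-module `log_p(R^×)`
    let c : ℤ_[p] := ⟨(n : ℚ_[p])⁻¹, hnorm'⟩
    have hc : c • Algebra.trace k k' z = (c : ℚ_[p]) • Algebra.trace k k' z := by
      rw [← IsScalarTower.algebraMap_smul ℚ_[p] c (Algebra.trace k k' z), PadicInt.algebraMap_apply]
    change (c : ℚ_[p]) • Algebra.trace k k' z ∈ logUnits k
    rw [← hc]
    exact smul_mem_logUnits p k c htr

end NormTrace

/-! ## §2 Item (X) at every degree prime to `p` (no tameness) -/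

section Packet

variable (p : ℕ) [Fact p.Prime]
variable {I : Type} [Fintype I] [DecidableEq I] [Nonempty I]
variable (k : I → Type) [∀ i, NontriviallyNormedField (k i)] [∀ i, NormedAlgebra ℚ_[p] (k i)]
  [∀ i, IsUltrametricDist (k i)] [∀ i, ProperSpace (k i)]
variable (k' : I → Type) [∀ i, NontriviallyNormedField (k' i)] [∀ i, NormedAlgebra ℚ_[p] (k' i)]
  [∀ i, IsUltrametricDist (k' i)] [∀ i, ProperSpace (k' i)]

/-- **Item (X) of the G1-Θ memo at EVERY degree prime to `p`, with NO tameness and NO `p > 2` hypothesis**: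
embeddings `σ_i : k_i → k'_i` of `p`-adic fields with `p ∤ [k'_i : σ_i k_i]`, a packet morphism `φ` with
`φ(ι_i(a)) = ι'_i(σ_i a)`, slot elements `g_i ∈ k_i^×` ⇒
`log μ̄(hull(⋃_γ γ·⋃_i ι_i(g_i)·(R_I)^∼)) ≤ log μ̄'(hull'(⋃_{γ'} γ'·⋃_i ι'_i(σ_i g_i)·(R'_I)^∼))`
(the normalised-trace retractions of `exists_logUnits_retraction_of_not_dvd` fed to
`packetLogμ_packetHull_orbit_slotUnion_le_of_retraction`).
[cite: Mochizuki2012, IUTchIV Thm 1.10 proof Step (v) p. 27–28, Prop. 1.2 (i)(ii) p. 10] [cite: DupuyHilado2025, §4.7, §4.9, §4.12] -/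
theorem packetLogμ_packetHull_orbit_slotUnion_le_of_not_dvd
    (σ : ∀ i, k i →ₐ[ℚ_[p]] k' i)
    (hn : ∀ i, letI := (σ i).toRingHom.toAlgebra; ¬ p ∣ Module.finrank (k i) (k' i))
    (φ : PacketAlgebra p k →ₐ[ℚ_[p]] PacketAlgebra p k')
    (hφ : ∀ (i : I) (a : k i), φ (iota p k i a) = iota p k' i (σ i a))
    (g : Π i, k i) (hg : ∀ i, g i ≠ 0) :
    packetLogμ p k (packetHull p k
        (⋃ γ : indTwo p k, γ • ⋃ i, iota p k i (g i) • (normalizedPacket p k : Set (PacketAlgebra p k)))) ≤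
      packetLogμ p k' (packetHull p k'
        (⋃ γ : indTwo p k', γ • ⋃ i, iota p k' i (σ i (g i)) •
          (normalizedPacket p k' : Set (PacketAlgebra p k')))) := by
  choose r hr hrΛ using fun i => exists_logUnits_retraction_of_not_dvd p (σ i) (hn i)
  exact packetLogμ_packetHull_orbit_slotUnion_le_of_retraction p k k' φ σ hφ r hr hrΛ g hg

/-- **Item (X), `σ`-only form** (the packet morphism `φ = ⊗σ_i` is supplied by `exists_packetAlgHom_of_algHom`):
`p ∤ [k'_i : σ_i k_i]` for every `i`, `g_i ∈ k_i^×` ⇒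
`log μ̄(hull(⋃_γ γ·⋃_i ι_i(g_i)·(R_I)^∼)) ≤ log μ̄'(hull'(⋃_{γ'} γ'·⋃_i ι'_i(σ_i g_i)·(R'_I)^∼))`.
[cite: Mochizuki2012, IUTchIV Thm 1.10 proof Step (v) p. 27–28] [cite: DupuyHilado2025, §4.7, §4.9, §4.12] -/
theorem packetLogμ_packetHull_orbit_slotUnion_le_of_not_dvd'
    (σ : ∀ i, k i →ₐ[ℚ_[p]] k' i)
    (hn : ∀ i, letI := (σ i).toRingHom.toAlgebra; ¬ p ∣ Module.finrank (k i) (k' i))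
    (g : Π i, k i) (hg : ∀ i, g i ≠ 0) :
    packetLogμ p k (packetHull p k
        (⋃ γ : indTwo p k, γ • ⋃ i, iota p k i (g i) • (normalizedPacket p k : Set (PacketAlgebra p k)))) ≤
      packetLogμ p k' (packetHull p k'
        (⋃ γ : indTwo p k', γ • ⋃ i, iota p k' i (σ i (g i)) •
          (normalizedPacket p k' : Set (PacketAlgebra p k')))) := by
  obtain ⟨φ, hφ⟩ := exists_packetAlgHom_of_algHom p k k' σ
  exact packetLogμ_packetHull_orbit_slotUnion_le_of_not_dvd p k k' σ hn φ hφ g hg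

/-- **Item (X), norm-matched form** (the shape the G1-Θ assembly consumes: big-field slots `g'_i` with
`‖g'_i‖ = ‖g_i‖`, not necessarily `σ_i g_i`): `p ∤ [k'_i : σ_i k_i]`, `g_i ∈ k_i^×`, `‖g'_i‖ = ‖g_i‖` ⇒
`log μ̄(hull(⋃_γ γ·⋃_i ι_i(g_i)·(R_I)^∼)) ≤ log μ̄'(hull'(⋃_{γ'} γ'·⋃_i ι'_i(g'_i)·(R'_I)^∼))`.
[cite: Mochizuki2012, IUTchIV Thm 1.10 proof Step (v) p. 27–28] [cite: DupuyHilado2025, §4.7, §4.9, §4.12] -/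
theorem packetLogμ_packetHull_orbit_slotUnion_le_of_not_dvd_of_norm_eq
    (σ : ∀ i, k i →ₐ[ℚ_[p]] k' i)
    (hn : ∀ i, letI := (σ i).toRingHom.toAlgebra; ¬ p ∣ Module.finrank (k i) (k' i))
    (g : Π i, k i) (hg : ∀ i, g i ≠ 0) (g' : Π i, k' i) (hgg' : ∀ i, ‖g' i‖ = ‖g i‖) :
    packetLogμ p k (packetHull p k
        (⋃ γ : indTwo p k, γ • ⋃ i, iota p k i (g i) • (normalizedPacket p k : Set (PacketAlgebra p k)))) ≤
      packetLogμ p k' (packetHull p k'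
        (⋃ γ : indTwo p k', γ • ⋃ i, iota p k' i (g' i) • (normalizedPacket p k' : Set (PacketAlgebra p k')))) := by
  have hσg : ∀ i, σ i (g i) ≠ 0 := fun i => (map_ne_zero (σ i)).mpr (hg i)
  have hn' : ∀ i, ‖g' i‖ = ‖σ i (g i)‖ := fun i => by rw [hgg' i, norm_map_algHom (σ i) (g i)]
  rw [iUnion_iota_smul_normalizedPacket_eq_of_norm_eq p k' (fun i => σ i (g i)) g' hσg hn']
  exact packetLogμ_packetHull_orbit_slotUnion_le_of_not_dvd' p k k' σ hn g hg

end Packet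

end Literature.IUT.LogVolume

end
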